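import Summits.ResolutionOfSingularities.ResolutionOfSingularities.Theorems.WildQuotientsWildQuotientResolutionS1aProducerStep
import Summits.ResolutionOfSingularities.ResolutionOfSingularities.Theorems.WildQuotientsWildQuotientResolutionS1aCoarseChart
import Literature.AlgebraicGeometry.Resolution.CobordantBlowupGlobal

/-!
# S1a — H4b: the NODE ATLAS (state invariant of the kill game) and ADMISSIBLE CENTRES [OURS · L1 W4.5c · idea-2 g15]

NOT a statement of the manuscript; counted 0. AI-level work, weaker than expert review. H3-SCHEME memo (G2)(G3)
(`h123/H3-SCHEME.md`, tri-1 20:38:53Z / tri-2 20:39:25Z PASS; plan-1 ruling on Q1–Q4 pending at typing time).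

* `IsNodeChart p ρ g₀ O` — a `G`-STABLE affine open `O` of the model `V` (an index of the tree poset
  `ActionOver.StableAffineOpens`, moreover affine) whose coordinate ring is the degree-`0` part of a TAME NODE
  `(B, 𝒜, σ)` (H3 `IsTameNode`, grading group LITERALLY `Π j : Fin m, ZMod (r j)` as in D2-T), the ring iso
  intertwining the action of the fixed generator `g₀` on sections (`(ρ.aut g₀⁻¹).hom.appLE O O _`, the treeʼs
  convention `ActionOver.act`) with `σ`;
* `NodeAtlas p ρ g₀` — every point of `V` lies in a node chart (THE STATE INVARIANT);
* PROVED projections to two clauses of D2-T `S1.KillTameModel`: `locallyDiagonalRootRegular_of_nodeAtlas`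
  (`LocallyDiagonalRootRegular V`, via H3 `isTameRootChart_degreeZero_of_isTameNode` and the 3-line
  `isDiagonalRootChart_of_isTameRootChart`) and `exists_stableAffineOpens_of_nodeAtlas` (the stable affine cover);
* `IsAdmissibleCentre p ρ g₀ 𝒦 d` — a `G`-stable tree `ReesFiltration 𝒦` on `V` such that every point has a node
  chart which is either a CENTRE chart (`IsCentreChart`: there `𝒦` is the DEGREE-0 TRACE, H4a
  `CoarseChart.traceFiltration`, of a K1′-regular σ-adapted homogeneous weighted centre with `0 < c`, and `d` is a
  Veronese degree, H4a `VeroneseNormalised`) or IDLE (`IsIdleChart`: there `𝒦` is the unit filtration; tri-1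
  20:46:26Z (R-d)) — the hypothesis package of the MOVE (H4c): `Vʼ := Bl_{𝒦 d}(V)`.
-/

set_option linter.dupNamespace false

noncomputable section

open CategoryTheory AlgebraicGeometry TopologicalSpace
open Literature.AlgebraicGeometry.Resolution Literature.AlgebraicGeometry.RelativeSpec
open Summit.ResolutionOfSingularities.ResolutionOfSingularities.Theorems.WildQuotientResolution.S1
open Summit.ResolutionOfSingularities.ResolutionOfSingularities.Theorems.WildQuotientResolution.S1.ProducerStep

namespace Summit.ResolutionOfSingularities.ResolutionOfSingularities.Theorems.WildQuotientResolution.S1.NodeAtlas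

universe u

/-! ## Tame ⇒ diagonal root chart -/

/-- A tame root chart is a diagonal root chart (forget (T1), (T2)). -/
theorem isDiagonalRootChart_of_isTameRootChart {A : Type u} [CommRing A] (h : IsTameRootChart A) :
    IsDiagonalRootChart A := by
  obtain ⟨m, r, B, _, 𝒜, _, hN, hR, -, -, he⟩ := h
  exact ⟨m, r, B, inferInstance, 𝒜, inferInstance, hN, hR, he⟩

/-- Tame root charts are invariant under ring isomorphism of the presented ring. -/
theorem IsTameRootChart.of_ringEquiv {A A' : Type u} [CommRing A] [CommRing A'] (e : A' ≃+* A)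
    (h : IsTameRootChart A) : IsTameRootChart A' := by
  obtain ⟨m, r, B, _, 𝒜, _, hN, hR, hT1, hT2, ⟨e'⟩⟩ := h
  exact ⟨m, r, B, inferInstance, 𝒜, inferInstance, hN, hR, hT1, hT2, ⟨e.trans e'⟩⟩

/-! ## Node charts and the node atlas -/

section Atlas

variable (p : ℕ) {V Y : Scheme.{u}} {q : V ⟶ Y} {G : Type*} [Group G] (ρ : ActionOver q G) (g₀ : G)

/-- **Node chart**: a `G`-stable open `O` of `V`, affine and affine over the base, whose coordinate ring is the
degree-`0` part of a tame node `(B, 𝒜, σ)` graded by `Π j : Fin m, ZMod (r j)`, the iso intertwining the action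
of `g₀` on `Γ(V, O)` (pull back along `g₀⁻¹`, the treeʼs `ActionOver.act` convention) with `σ`. [OURS · L1 W4.5c] -/
def IsNodeChart (O : ρ.StableAffineOpens) : Prop :=
  IsAffineOpen O.1 ∧
  ∃ (m : ℕ) (r : Fin m → ℕ) (B : Type u) (_ : CommRing B) (𝒜 : (Π j : Fin m, ZMod (r j)) → AddSubgroup B)
    (_ : GradedRing 𝒜) (σ : B ≃+* B) (e : Γ(V, O.1) ≃+* ↥(𝒜 0)),
    IsTameNode p B 𝒜 σ ∧
    ∀ t : Γ(V, O.1),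
      ((e ((ρ.aut g₀⁻¹).hom.appLE O.1 O.1 (O.2.1 g₀⁻¹).ge t) : ↥(𝒜 0)) : B) = σ ((e t : ↥(𝒜 0)) : B)

/-- **Node atlas** (the STATE INVARIANT of the kill game): every point of `V` lies in a node chart.
[OURS · L1 W4.5c] -/
def NodeAtlas : Prop :=
  ∀ v : V, ∃ O : ρ.StableAffineOpens, v ∈ O.1 ∧ IsNodeChart p ρ g₀ O

variable {p ρ g₀}

/-- The coordinate ring of a node chart is a tame root chart. -/
theorem isTameRootChart_of_isNodeChart {O : ρ.StableAffineOpens} (h : IsNodeChart p ρ g₀ O) :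
    IsTameRootChart Γ(V, O.1) := by
  obtain ⟨-, m, r, B, _, 𝒜, _, σ, e, hnode, -⟩ := h
  exact IsTameRootChart.of_ringEquiv e (isTameRootChart_degreeZero_of_isTameNode p r B 𝒜 σ hnode)

/-- **Projection 1**: a node atlas gives the upstairs pin `LocallyDiagonalRootRegular V` of `KillTameModel`. -/
theorem locallyDiagonalRootRegular_of_nodeAtlas (h : NodeAtlas p ρ g₀) : LocallyDiagonalRootRegular V := by
  intro v
  obtain ⟨O, hv, hO⟩ := h v
  exact ⟨⟨O.1, hO.1⟩, hv, isDiagonalRootChart_of_isTameRootChart (isTameRootChart_of_isNodeChart hO)⟩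

/-- **Projection 2**: a node atlas gives the stable-affine-cover clause of `KillTameModel`. -/
theorem exists_stableAffineOpens_of_nodeAtlas (h : NodeAtlas p ρ g₀) :
    ∀ v : V, ∃ O : ρ.StableAffineOpens, v ∈ O.1 :=
  fun v => (h v).imp fun _ hO => hO.1

end Atlas

/-! ## Admissible centres -/

section Centre

variable (p : ℕ) {V Y : Scheme.{u}} {q : V ⟶ Y} {G : Type*} [Group G] (ρ : ActionOver q G) (g₀ : G)

/-- **The centre data on one node chart**: the node `(B, 𝒜, σ, e)` of the chart together with a K1′-REGULAR,
`σ`-ADAPTED, HOMOGENEOUS weighted centre `(f, w)`, `0 < c`, whose DEGREE-0 TRACE is the given filtration `𝒦` on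
`Γ(V, O)` and for which `d` is a VERONESE DEGREE. [OURS · L1 W4.5c] -/
def IsCentreChart (𝒦 : ReesFiltration V) (d : ℕ) (O : ρ.StableAffineOpens) : Prop :=
  ∃ (hO : IsAffineOpen O.1) (m : ℕ) (r : Fin m → ℕ) (B : Type u) (_ : CommRing B)
    (𝒜 : (Π j : Fin m, ZMod (r j)) → AddSubgroup B) (_ : GradedRing 𝒜) (σ : B ≃+* B)
    (e : Γ(V, O.1) ≃+* ↥(𝒜 0)),
    IsTameNode p B 𝒜 σ ∧
    (∀ t : Γ(V, O.1),
      ((e ((ρ.aut g₀⁻¹).hom.appLE O.1 O.1 (O.2.1 g₀⁻¹).ge t) : ↥(𝒜 0)) : B) = σ ((e t : ↥(𝒜 0)) : B)) ∧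
    ∃ (c : ℕ) (f : Fin c → B) (δ : Fin c → Π j : Fin m, ZMod (r j)) (w : Fin c → ℕ),
      0 < c ∧ (∀ i, f i ∈ 𝒜 (δ i)) ∧ (∀ i, 0 < w i) ∧
      RingTheory.Sequence.IsRegular B (List.ofFn f) ∧ IsRegularRing (B ⧸ Ideal.span (Set.range f)) ∧
      (∀ n : ℕ, ((weightedFiltration f w).ideal n).map (σ : B →+* B) ≤ (weightedFiltration f w).ideal n) ∧
      (∀ n : ℕ, (𝒦.filtration ⟨O.1, hO⟩).ideal n =
        ((CoarseChart.traceFiltration 𝒜 f w).ideal n).comap (e : Γ(V, O.1) →+* ↥(𝒜 0))) ∧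
      CoarseChart.VeroneseNormalised 𝒜 f w d

/-- **Idle chart** for the centre `𝒦`: a node chart on which `𝒦` is the UNIT filtration (the chart misses the
centre; the blow-up is an isomorphism over it and the node is inherited verbatim). tri-1 20:46:26Z (R-d).
[OURS · L1 W4.5c] -/
def IsIdleChart (𝒦 : ReesFiltration V) (O : ρ.StableAffineOpens) : Prop :=
  ∃ h : IsNodeChart p ρ g₀ O, ∀ n : ℕ, (𝒦.filtration ⟨O.1, h.1⟩).ideal n = ⊤

/-- **Admissible centre** with Veronese degree `d`: a `G`-STABLE Rees filtration `𝒦` on `V` such that every point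
lies in a node chart which is EITHER a centre chart (there `𝒦` is the degree-0 trace of a K1′ σ-adapted
homogeneous weighted centre with Veronese degree `d`) OR idle (there `𝒦` is the unit filtration) — tri-1 (R-d):
centre charts are only required to cover the centre. The MOVE of the game is `Vʼ := Bl_{𝒦 d}(V)` (H4c).
[OURS · L1 W4.5c] -/
def IsAdmissibleCentre (𝒦 : ReesFiltration V) (d : ℕ) : Prop :=
  0 < d ∧ (∀ (g : G) (n : ℕ), (𝒦.ideal n).comap (ρ.aut g).hom = 𝒦.ideal n) ∧
    ∀ v : V, ∃ O : ρ.StableAffineOpens, v ∈ O.1 ∧ (IsCentreChart p ρ g₀ 𝒦 d O ∨ IsIdleChart p ρ g₀ 𝒦 O)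

variable {p ρ g₀}

/-- A centre chart is in particular a node chart. -/
theorem isNodeChart_of_isCentreChart {𝒦 : ReesFiltration V} {d : ℕ} {O : ρ.StableAffineOpens}
    (h : IsCentreChart p ρ g₀ 𝒦 d O) : IsNodeChart p ρ g₀ O := by
  obtain ⟨hO, m, r, B, _, 𝒜, _, σ, e, hnode, hσ, -⟩ := h
  exact ⟨hO, m, r, B, inferInstance, 𝒜, inferInstance, σ, e, hnode, hσ⟩

/-- An admissible centre presupposes (re-proves) the node atlas. -/
theorem nodeAtlas_of_isAdmissibleCentre {𝒦 : ReesFiltration V} {d : ℕ} (h : IsAdmissibleCentre p ρ g₀ 𝒦 d) :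
    NodeAtlas p ρ g₀ :=
  fun v => (h.2.2 v).imp fun _ hO => ⟨hO.1, hO.2.elim isNodeChart_of_isCentreChart fun hi => hi.1⟩

/-- `G`-stability of the blown-up piece: the hypothesis `hρ` of the treeʼs `IsBlowup.liftAction`. -/
theorem comap_aut_eq_of_isAdmissibleCentre {𝒦 : ReesFiltration V} {d : ℕ} (h : IsAdmissibleCentre p ρ g₀ 𝒦 d)
    (g : G) : (𝒦.ideal d).comap (ρ.aut g).hom = 𝒦.ideal d :=
  h.2.1 g d

end Centre

end Summit.ResolutionOfSingularities.ResolutionOfSingularities.Theorems.WildQuotientResolution.S1.NodeAtlas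

end
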